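import Mathlib
import Literature.MathematicalPhysics.QuantumFieldTheory.Balaban1983to89.B5Hk165L2Zd

/-!
# [B5] (1.100), (1.102), (1.103) p.34 — `Q'G'Q'*`, its inverse, and `H_k = G'Q'*(Q'G'Q'*)⁻¹` as bounded operators on `ℓ²(ℤ^d)`

[B5] = T. Bałaban, *Propagators and renormalization transformations for lattice gauge theories. I*, Commun.
Math. Phys. **95** (1984) 17–40 [`Balaban1984PropagatorsI`].  PRINTED TEXT (TEXT LOCATIONS ONLY — nothing printed
enters as a hypothesis; quotations checked against the page render `…1984-cmp95-propagators-rt-I-p018-x2.png`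
read as an image): p. 34 [PDF 18]: «and can be bounded as follows  a⁻¹(φ − 1)φ⁻¹ ≤ QGQ* ≤ a⁻¹I.» (1.100);
«from which it follows that it is bounded from below and above by positive constants dependent on d only (for
a = 1). The same property holds for QGQ*. The condition QA = B gives the equation −QGQ*ω = B, −ω = (QGQ*)⁻¹B,»
(1.102) «so finally we get the representation H_kB = GQ*(QGQ*)⁻¹B.» (1.103) «This representation allows us to
reduce a proof of properties of H_k to the corresponding properties of G.»

WHAT THIS FILE PROVES (scalar analogue on the whole lattice `ℤ^d`, in the tree's un-rescaled block convention:
coarse sites `y ∈ ℤ^d`, fine sites `p ∈ ℤ^d` in the blocks `B n y` of `(n+1)^d` sites; `kerQGQ n a` = the scalar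
unit-lattice kernel of `Q'G'Q'*` of `B6QGQLower276`, `Kinv n a` = its B4-Sect.-5 inverse kernel of
`B5Hk103ScalarZd`, `gq n a` = the kernel of `G'Q'*`, `kerH = Σ' gq·Kinv` = the scalar `H` of (1.103), `HBZd` = `H`
on square-summable coarse data (`B5Hk165L2Zd`)).  The predecessors of this column treat `Q'G'Q'*` through its
finite-volume quadratic form (`B6QGQFourier275Zd.qGq_upper_printed` / `qGq_lower_printed`, fields cut off to a
finite `T`) and `(Q'G'Q'*)⁻¹` ENTRYWISE (`B5Hk103ScalarZd.tsum_Kinv_mul_kerQGQ`: `Σ'_y K⁻¹(y',y)K(y,z) = δ`).  Here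
both become OPERATORS ON `ℓ²(ℤ^d)` in the function/`tsum` language of `B5Ineq167L2Zd`/`B5Hk165L2Zd`, and the
three displayed relations of p. 34 are proved for EVERY square-summable coarse field `B`, every `n`, every `a > 0`:

* (§2, (1.100) on `ℓ²`) `KZd n a B = Q'G'Q'*B` is absolutely convergent row by row, square-summable (Schur test),
  its form is the limit of the finite-volume forms along the finite `T ⊂ ℤ^d` (dominated convergence on
  `ℤ^d × ℤ^d` under the Young majorant `(B(y)² + B(y')²)|K(y,y')|/2`), hence
  `2γ₀(d,a)·‖B‖² ≤ ⟨B, Q'G'Q'*B⟩_{ℤ^d} ≤ a⁻¹‖B‖²` (`inner_KZd_ge`, `inner_KZd_le`; `2γ₀ = (a + 4d(π²/4)^{d+1})⁻¹`,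
  `inner_KZd_ge'`) — constants depending on `d, a` only (`inner_KZd_bounds_exists`).
* (§3) `KinvZd n a B = (Q'G'Q'*)⁻¹B = Δ^{scalar}_{n,a}B + aB` on `ℓ²` (`KinvZd_eq`), square-summable, with the form
  identity `⟨B, (Q'G'Q'*)⁻¹B⟩ = ⟨B, Δ^{scalar}B⟩ + a‖B‖²` and the dual two-sided bounds
  `a‖B‖² ≤ ⟨B, (Q'G'Q'*)⁻¹B⟩ ≤ (2γ₀)⁻¹‖B‖²` (`inner_KinvZd_bounds`; from (1.67) on `ℓ²` and `⟨∂₁B, ∂₁B⟩ ≤ 4d‖B‖²`).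
* (§4, (1.102) on `ℓ²`) `Q'G'Q'*` and `(Q'G'Q'*)⁻¹` are MUTUALLY INVERSE on `ℓ²(ℤ^d)`:
  `(Q'G'Q'*)⁻¹(Q'G'Q'*B) = B = Q'G'Q'*((Q'G'Q'*)⁻¹B)` (`KinvZd_KZd`, `KZd_KinvZd`; Fubini under exponential
  majorants, the symmetry of both kernels for the second); consequently `ω = −(Q'G'Q'*)⁻¹B` is THE square-summable
  solution of `−Q'G'Q'*ω = B` (`eq1102_exists`, `eq1102_unique`).
* (§5, (1.103) on `ℓ²`) `(H B)(p) = Σ'_{y'} (G'Q'*)(p,y')·((Q'G'Q'*)⁻¹B)(y')` for every fine site `p`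
  (`HBZd_eq_gq_KinvZd`): the operator `H` of `B5Hk165L2Zd` IS the composition `G'Q'* ∘ (Q'G'Q'*)⁻¹` of two
  operators, the second acting on `ℓ²(ℤ^d)` — the reading of (1.103) that «allows us to reduce a proof of
  properties of H_k to the corresponding properties of G».

HONEST SCOPE.  (i) Scalar analogue only (no vector indices, no axial-gauge constraint `R∂* = 0`, so no `R`, `λ`
of (1.93)–(1.98)), whole lattice `ℤ^d` (no torus), as in the whole scalar-`ℤ^d` column of this package; the
printed lower bound of (1.100) is the OPERATOR `a⁻¹(φ−1)φ⁻¹`, of which only the «positive constants» consequence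
is shadowed here (constant `2γ₀(d,a)` of the column's `qGq_lower_printed`, i.e. [B6] (2.76) by the printed route;
no claim about `φ`).  (ii) The finite-volume inequalities are the column's (`B6QGQFourier275Zd`); the new
content is the passage to ALL of `ℓ²(ℤ^d)` and the operator algebra (§3–§5).  (iii) The tree already has the
lower bound and the inverse of `Q'G'Q'*` on the B4 Hilbert space `H (idx 1 univ)` in the `opA` formalism with the
Combes–Thomas constant `γ_Q = (36^d(4d+a))⁻¹` (`B6QGQLower276.qGq_l2_lower`, `qGq_inverse`); the present file
works on `X d → ℝ` with `Summable (B²)`, identifies the `ℓ²`-inverse with the column's KERNEL `Kinv` (both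
compositions), and carries the sharp constants `2γ₀`, `a⁻¹`, `a`, `(2γ₀)⁻¹`; no equivalence with the `opA` objects
is asserted.  (iv) The `ℓ² → ℓ²` bound of `KZd_l2` is qualitative (Schur constant `(c_Q K_d(δ_Q))²`, mesh-dependent
through `c_Q(d,n,a)`, `δ_Q(d,n,a)`); the FORM bounds of §2–§3 are mesh-uniform.  (v) `ℓ²` data only.  NOT summit
progress: infrastructure for the scalar model of [B5] §1 only.

ABSOLUTE-RULE CENSUS: hypotheses of the theorems below are `0 < a`, `Summable fun x => B x ^ 2` (and, in
`eq1102_unique`, `Summable fun x => ω x ^ 2` with the equation `−Q'G'Q'*ω = B`; in `summable_pair`, generic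
row/column data of a kernel) only; no `Prop`-valued printed statement, no internally minted fact.  Citations:
[Balaban1984PropagatorsI] (1.100), (1.102), (1.103) p. 34 and (1.65) p. 29 — text locations; everything else
[folklore].  Unit `b2b-balaban-pv23-g10` (SURGE NODE PROVER #23 gen 10, scalar whole-lattice `ℤ^d` column,
self-row B5-QGQ-INVERSE-L2-ZD); staged byte-identically under `HOME/lean/BalabanYm4/`.
-/

namespace Literature.MathematicalPhysics.QuantumFieldTheory.Balaban1983to89.B5QGQInverseL2Zd

open Filter Topology
open B6QGQLower276 (X e B blk mem_B kerQGQ cQ deltaQ cQ_pos deltaQ_pos abs_kerQGQ_le kerQGQ_symm)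
open B4Sect5Proof (latticeConst latticeConst_nonneg)
open B6QGQDecay237 (cU deltaU cU_pos deltaU_pos cInv deltaInv cInv_pos deltaInv_pos)
open B6QGQFourier275Zd (twoGamma0 twoGamma0_pos qGq_upper_printed qGq_lower_printed)
open B5Hk103ScalarZd (Kinv kerH gq abs_Kinv_le abs_gq_le summable_expX tsum_expX_le tsum_Kinv_mul_kerQGQ
  tsum_mul_tsum_comm)
open B5Hk103Unique (summable_mul_of_sq summable_sq_shift)
open B5Hk103Minimizer (energy)
open B5Hk165ActionZd (actionKer)
open B5Hk165PolarZd (Kinv_symm)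
open B5Ineq167SharpUpperZd (gamma1Sharp gamma1Sharp_pos twoGamma0_eq_inv)
open B5Ineq167L2Zd (actionFormZd deltaApply actionFormZd_eq_inner actionFormZd_nonneg ineq167_upper_l2
  summable_deltaApply_row)
open B5Hk165L2Zd (schur_tsum_signed HBZd summable_HBZd_row deltaApply_l2)

noncomputable section

variable {d : ℕ}

/-! ## §1  `ℓ²(ℤ^d)` toolkit [folklore] -/

/-- **Cauchy–Schwarz on `ℓ²(ℤ^d)`**: `(Σ' f g)² ≤ (Σ' f²)(Σ' g²)` for square-summable `f, g` (from the finite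
inequality on every window). [folklore] -/
theorem tsum_mul_sq_le {f g : X d → ℝ} (hf : Summable fun y => f y ^ 2) (hg : Summable fun y => g y ^ 2) :
    (∑' y, f y * g y) ^ 2 ≤ (∑' y, f y ^ 2) * ∑' y, g y ^ 2 := by
  have hfg : Summable fun y => f y * g y := summable_mul_of_sq hf hg
  have hA : 0 ≤ ∑' y, f y ^ 2 := tsum_nonneg fun _ => sq_nonneg _
  have hB : 0 ≤ ∑' y, g y ^ 2 := tsum_nonneg fun _ => sq_nonneg _
  set M : ℝ := Real.sqrt ((∑' y, f y ^ 2) * ∑' y, g y ^ 2) with hM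
  have hfin : ∀ s : Finset (X d), |∑ y ∈ s, f y * g y| ≤ M := fun s => by
    refine Real.abs_le_sqrt ?_
    calc (∑ y ∈ s, f y * g y) ^ 2 ≤ (∑ y ∈ s, f y ^ 2) * ∑ y ∈ s, g y ^ 2 :=
          Finset.sum_mul_sq_le_sq_mul_sq s f g
      _ ≤ (∑' y, f y ^ 2) * ∑' y, g y ^ 2 :=
          mul_le_mul (hf.sum_le_tsum s fun _ _ => sq_nonneg _) (hg.sum_le_tsum s fun _ _ => sq_nonneg _)
            (Finset.sum_nonneg fun _ _ => sq_nonneg _) hA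
  have h1 : ∑' y, f y * g y ≤ M := hfg.tsum_le_of_sum_le fun s => (le_abs_self _).trans (hfin s)
  have h2 : -∑' y, f y * g y ≤ M := by
    rw [← tsum_neg]
    exact hfg.neg.tsum_le_of_sum_le fun s => by
      rw [Finset.sum_neg_distrib]; exact (neg_le_abs _).trans (hfin s)
  have h3 : |∑' y, f y * g y| ≤ M := abs_le.2 ⟨by linarith, h1⟩
  calc (∑' y, f y * g y) ^ 2 = |∑' y, f y * g y| ^ 2 := (sq_abs _).symm
    _ ≤ M ^ 2 := pow_le_pow_left₀ (abs_nonneg _) h3 2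
    _ = (∑' y, f y ^ 2) * ∑' y, g y ^ 2 := Real.sq_sqrt (mul_nonneg hA hB)

/-- `|B(z)| ≤ ‖B‖_{ℓ²}`. [folklore] -/
theorem abs_le_sqrt_tsum_sq {Bf : X d → ℝ} (hB : Summable fun y => Bf y ^ 2) (z : X d) :
    |Bf z| ≤ Real.sqrt (∑' y, Bf y ^ 2) := by
  refine Real.abs_le_sqrt ?_
  simpa using hB.sum_le_tsum {z} fun _ _ => sq_nonneg _

/-- The partial sums of a summable family converge along the finite windows. [folklore] -/
theorem tendsto_finset_sum {f : X d → ℝ} (hf : Summable f) :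
    Tendsto (fun T : Finset (X d) => ∑ y ∈ T, f y) atTop (𝓝 (∑' y, f y)) :=
  hf.hasSum

/-- **`⟨∂₁B, ∂₁B⟩ ≤ 4d·‖B‖²_{ℓ²}`**: the unit-lattice Dirichlet form is bounded on `ℓ²(ℤ^d)`. [folklore] -/
theorem energy_le_four_d {Bf : X d → ℝ} (hB : Summable fun y => Bf y ^ 2) :
    energy Bf ≤ 4 * d * ∑' y, Bf y ^ 2 := by
  unfold energy
  have hμ : ∀ μ : Fin d, ∑' p, (Bf p - Bf (p + e μ)) ^ 2 ≤ 4 * ∑' y, Bf y ^ 2 := fun μ => by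
    have hs := summable_sq_shift hB (e μ)
    have hshift : ∑' p, Bf (p + e μ) ^ 2 = ∑' p, Bf p ^ 2 :=
      (Equiv.addRight (e μ)).tsum_eq fun p => Bf p ^ 2
    have hmaj : Summable fun p => 2 * (Bf p ^ 2 + Bf (p + e μ) ^ 2) := (hB.add hs).mul_left 2
    have hsub : Summable fun p => (Bf p - Bf (p + e μ)) ^ 2 :=
      Summable.of_nonneg_of_le (fun p => sq_nonneg _)
        (fun p => by nlinarith [sq_nonneg (Bf p + Bf (p + e μ))]) hmaj
    calc ∑' p, (Bf p - Bf (p + e μ)) ^ 2 ≤ ∑' p, 2 * (Bf p ^ 2 + Bf (p + e μ) ^ 2) :=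
          Summable.tsum_le_tsum (fun p => by nlinarith [sq_nonneg (Bf p + Bf (p + e μ))]) hsub hmaj
      _ = 2 * (∑' p, Bf p ^ 2 + ∑' p, Bf (p + e μ) ^ 2) := by rw [tsum_mul_left, hB.tsum_add hs]
      _ = 4 * ∑' y, Bf y ^ 2 := by rw [hshift]; ring
  calc ∑ μ : Fin d, ∑' p, (Bf p - Bf (p + e μ)) ^ 2 ≤ ∑ μ : Fin d, 4 * ∑' y, Bf y ^ 2 :=
        Finset.sum_le_sum fun μ _ => hμ μ
    _ = 4 * d * ∑' y, Bf y ^ 2 := by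
        rw [Finset.sum_const, Finset.card_univ, Fintype.card_fin, nsmul_eq_mul]; ring

/-- **Young majorant for kernel forms on `ℓ²(ℤ^d)`**: if the rows and the columns of `|k|` are summable with sums
`≤ R`, then `(x,y) ↦ B(x)·k(x,y)·B(y)` is absolutely summable on `ℤ^d × ℤ^d` for `B ∈ ℓ²(ℤ^d)`
(`|B(x)B(y)| ≤ (B(x)² + B(y)²)/2`). [folklore] -/
theorem summable_pair {k : X d → X d → ℝ} {R : ℝ} (hrow : ∀ x, Summable fun y => |k x y|)
    (hrowle : ∀ x, ∑' y, |k x y| ≤ R) (hcol : ∀ y, Summable fun x => |k x y|) (hcolle : ∀ y, ∑' x, |k x y| ≤ R)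
    {Bf : X d → ℝ} (hB : Summable fun y => Bf y ^ 2) :
    Summable fun xy : X d × X d => Bf xy.1 * (k xy.1 xy.2 * Bf xy.2) := by
  set F1 : X d × X d → ℝ := fun xy => Bf xy.1 ^ 2 * |k xy.1 xy.2| with hF1
  set F2 : X d × X d → ℝ := fun yx => Bf yx.1 ^ 2 * |k yx.2 yx.1| with hF2
  have h10 : 0 ≤ F1 := fun xy => by simp only [hF1]; positivity
  have h20 : 0 ≤ F2 := fun yx => by simp only [hF2]; positivity
  have h1 : Summable F1 := by
    refine (summable_prod_of_nonneg h10).2 ⟨fun x => ?_, ?_⟩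
    · simpa only [hF1] using (hrow x).mul_left (Bf x ^ 2)
    · have hx : ∀ x, ∑' y, F1 (x, y) = Bf x ^ 2 * ∑' y, |k x y| := fun x => by
        simp only [hF1]; exact tsum_mul_left
      simp_rw [hx]
      exact Summable.of_nonneg_of_le (fun x => mul_nonneg (sq_nonneg _) (tsum_nonneg fun _ => abs_nonneg _))
        (fun x => mul_le_mul_of_nonneg_left (hrowle x) (sq_nonneg _)) (hB.mul_right R)
  have h2 : Summable F2 := by
    refine (summable_prod_of_nonneg h20).2 ⟨fun y => ?_, ?_⟩
    · simpa only [hF2] using (hcol y).mul_left (Bf y ^ 2)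
    · have hy : ∀ y, ∑' x, F2 (y, x) = Bf y ^ 2 * ∑' x, |k x y| := fun y => by
        simp only [hF2]; exact tsum_mul_left
      simp_rw [hy]
      exact Summable.of_nonneg_of_le (fun y => mul_nonneg (sq_nonneg _) (tsum_nonneg fun _ => abs_nonneg _))
        (fun y => mul_le_mul_of_nonneg_left (hcolle y) (sq_nonneg _)) (hB.mul_right R)
  have h3 : Summable fun xy : X d × X d => F2 xy.swap := h2.prod_symm
  refine Summable.of_norm_bounded ((h1.add h3).div_const 2) fun xy => ?_
  simp only [hF1, hF2, Prod.fst_swap, Prod.snd_swap]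
  rw [Real.norm_eq_abs, abs_mul, abs_mul]
  have hk : 0 ≤ |k xy.1 xy.2| := abs_nonneg _
  have hyoung : |Bf xy.1| * |Bf xy.2| ≤ (Bf xy.1 ^ 2 + Bf xy.2 ^ 2) / 2 := by
    nlinarith [sq_nonneg (|Bf xy.1| - |Bf xy.2|), sq_abs (Bf xy.1), sq_abs (Bf xy.2)]
  calc |Bf xy.1| * (|k xy.1 xy.2| * |Bf xy.2|) = |Bf xy.1| * |Bf xy.2| * |k xy.1 xy.2| := by ring
    _ ≤ (Bf xy.1 ^ 2 + Bf xy.2 ^ 2) / 2 * |k xy.1 xy.2| := mul_le_mul_of_nonneg_right hyoung hk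
    _ = (Bf xy.1 ^ 2 * |k xy.1 xy.2| + Bf xy.2 ^ 2 * |k xy.1 xy.2|) / 2 := by ring

/-! ## §2  `Q'G'Q'*` on `ℓ²(ℤ^d)` [print-located: «QGQ* ≤ a⁻¹I» (1.100); proved outright] -/

/-- `(Q'G'Q'* B)(z) = Σ'_y (Q'G'Q'*)(z,y)B(y)` — the averaged propagator `Q'G'Q'*` of (1.99)–(1.102) (scalar, unit
lattice: the kernel `kerQGQ` of `B6QGQLower276`) applied to an ARBITRARY coarse field on `ℤ^d` (absolutely convergent
for `B ∈ ℓ²`, `KZd_l2`). [cite: Balaban1984PropagatorsI, (1.100)–(1.102) p.34] -/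
def KZd (n : ℕ) (a : ℝ) (Bf : X d → ℝ) (z : X d) : ℝ := ∑' y : X d, kerQGQ n a z y * Bf y

/-- Row sums of `|(Q'G'Q'*)(z,·)|`: summable, `≤ c_Q·K_d(δ_Q)`. [folklore] -/
theorem abs_kerQGQ_row (n : ℕ) {a : ℝ} (ha : 0 < a) (z : X d) :
    (Summable fun y : X d => |kerQGQ n a z y|) ∧
      ∑' y : X d, |kerQGQ n a z y| ≤ cQ d n a * latticeConst d (deltaQ d n a) := by
  have hmaj : Summable fun y : X d => cQ d n a * Real.exp (-(deltaQ d n a * dist z y)) :=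
    (summable_expX (deltaQ_pos n ha) z).mul_left _
  have hS : Summable fun y : X d => |kerQGQ n a z y| :=
    Summable.of_nonneg_of_le (fun _ => abs_nonneg _) (fun y => abs_kerQGQ_le n ha z y) hmaj
  refine ⟨hS, ?_⟩
  calc ∑' y : X d, |kerQGQ n a z y| ≤ ∑' y : X d, cQ d n a * Real.exp (-(deltaQ d n a * dist z y)) :=
        Summable.tsum_le_tsum (fun y => abs_kerQGQ_le n ha z y) hS hmaj
    _ = cQ d n a * ∑' y : X d, Real.exp (-(deltaQ d n a * dist z y)) := tsum_mul_left
    _ ≤ cQ d n a * latticeConst d (deltaQ d n a) :=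
        mul_le_mul_of_nonneg_left (tsum_expX_le (deltaQ_pos n ha) z) (cQ_pos n ha).le

/-- Column sums of `|(Q'G'Q'*)(·,y)|`: summable, `≤ c_Q·K_d(δ_Q)` (the kernel is symmetric). [folklore] -/
theorem abs_kerQGQ_col (n : ℕ) {a : ℝ} (ha : 0 < a) (y : X d) :
    (Summable fun z : X d => |kerQGQ n a z y|) ∧
      ∑' z : X d, |kerQGQ n a z y| ≤ cQ d n a * latticeConst d (deltaQ d n a) := by
  have h := abs_kerQGQ_row n ha y
  have heq : (fun z : X d => |kerQGQ n a z y|) = fun z : X d => |kerQGQ n a y z| :=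
    funext fun z => by rw [kerQGQ_symm n ha z y]
  rw [heq]
  exact h

/-- **`Q'G'Q'*` is a bounded operator on `ℓ²(ℤ^d)`**: for `B ∈ ℓ²(ℤ^d)` every row series converges absolutely,
`Q'G'Q'*B ∈ ℓ²(ℤ^d)` and `‖Q'G'Q'*B‖² ≤ (c_Q K_d(δ_Q))²‖B‖²` (Schur test; a qualitative bound — the sharp,
mesh-uniform form bound is `inner_KZd_le` below). [cite: Balaban1984PropagatorsI, (1.100) p.34] -/
theorem KZd_l2 (n : ℕ) {a : ℝ} (ha : 0 < a) {Bf : X d → ℝ} (hB : Summable fun x => Bf x ^ 2) :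
    (∀ z, Summable fun y : X d => kerQGQ n a z y * Bf y) ∧ (Summable fun z => KZd n a Bf z ^ 2) ∧
      ∑' z, KZd n a Bf z ^ 2 ≤ (cQ d n a * latticeConst d (deltaQ d n a)) ^ 2 * ∑' y, Bf y ^ 2 := by
  obtain ⟨h1, h2, h3⟩ := schur_tsum_signed (fun z y => kerQGQ n a z y)
    ((tsum_nonneg fun _ => abs_nonneg _).trans (abs_kerQGQ_row n ha (0 : X d)).2)
    (fun z => (abs_kerQGQ_row n ha z).1) (fun z => (abs_kerQGQ_row n ha z).2)
    (fun y => (abs_kerQGQ_col n ha y).1) (fun y => (abs_kerQGQ_col n ha y).2) hB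
  have hK : ∀ z, KZd n a Bf z = ∑' y, Bf y * kerQGQ n a z y := fun z => tsum_congr fun y => mul_comm _ _
  have hK2 : (fun z => KZd n a Bf z ^ 2) = fun z => (∑' y, Bf y * kerQGQ n a z y) ^ 2 :=
    funext fun z => by rw [hK]
  refine ⟨fun z => (h1 z).congr fun y => mul_comm _ _, by rw [hK2]; exact h2, ?_⟩
  rw [show ∑' z, KZd n a Bf z ^ 2 = ∑' z, (∑' y, Bf y * kerQGQ n a z y) ^ 2 from by rw [hK2],
    pow_two (cQ d n a * latticeConst d (deltaQ d n a))]
  exact h3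

/-- Every row series `Σ'_y (Q'G'Q'*)(z,y)B(y)` converges absolutely (`B ∈ ℓ²`). [folklore] -/
theorem summable_KZd_row (n : ℕ) {a : ℝ} (ha : 0 < a) {Bf : X d → ℝ} (hB : Summable fun x => Bf x ^ 2) (z : X d) :
    Summable fun y : X d => kerQGQ n a z y * Bf y :=
  (KZd_l2 n ha hB).1 z

/-- `Q'G'Q'*B ∈ ℓ²(ℤ^d)` for `B ∈ ℓ²(ℤ^d)`. [folklore] -/
theorem summable_KZd_sq (n : ℕ) {a : ℝ} (ha : 0 < a) {Bf : X d → ℝ} (hB : Summable fun x => Bf x ^ 2) :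
    Summable fun z => KZd n a Bf z ^ 2 :=
  (KZd_l2 n ha hB).2.1

/-- The pair family `B(y)·(Q'G'Q'*)(y,y')·B(y')` is absolutely summable on `ℤ^d × ℤ^d` (`B ∈ ℓ²`). [folklore] -/
theorem summable_qGq_pair (n : ℕ) {a : ℝ} (ha : 0 < a) {Bf : X d → ℝ} (hB : Summable fun x => Bf x ^ 2) :
    Summable fun xy : X d × X d => Bf xy.1 * (kerQGQ n a xy.1 xy.2 * Bf xy.2) :=
  summable_pair (fun x => (abs_kerQGQ_row n ha x).1) (fun x => (abs_kerQGQ_row n ha x).2)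
    (fun y => (abs_kerQGQ_col n ha y).1) (fun y => (abs_kerQGQ_col n ha y).2) hB

/-- The form `⟨B, Q'G'Q'*B⟩_{ℤ^d} = Σ'_y B(y)(Q'G'Q'*B)(y)` as an unconditional sum over `ℤ^d × ℤ^d` (Fubini).
[folklore] -/
theorem inner_KZd_eq_tsum_prod (n : ℕ) {a : ℝ} (ha : 0 < a) {Bf : X d → ℝ} (hB : Summable fun x => Bf x ^ 2) :
    ∑' y, Bf y * KZd n a Bf y = ∑' xy : X d × X d, Bf xy.1 * (kerQGQ n a xy.1 xy.2 * Bf xy.2) := by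
  have hs := summable_qGq_pair n ha hB
  rw [hs.tsum_prod' fun y => hs.prod_factor y]
  exact tsum_congr fun y => by rw [KZd, ← tsum_mul_left]

/-- The column's finite-volume form `Σ_{y∈T} c(y) Σ_{y'∈T} (Q'G'Q'*)(y,y')c(y')` (the left side of
`B6QGQFourier275Zd.qGq_upper_printed`) as a cut-off unconditional sum over `ℤ^d × ℤ^d`. [folklore] -/
theorem qGqForm_eq_tsum_ite (n : ℕ) (a : ℝ) (T : Finset (X d)) (Bf : X d → ℝ) :
    ∑ y ∈ T, Bf y * ∑ y' ∈ T, kerQGQ n a y y' * Bf y'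
      = ∑' xy : X d × X d, if xy ∈ T ×ˢ T then Bf xy.1 * (kerQGQ n a xy.1 xy.2 * Bf xy.2) else 0 := by
  rw [tsum_eq_sum (s := T ×ˢ T) fun xy hxy => if_neg hxy, Finset.sum_product]
  refine Finset.sum_congr rfl fun y hy => ?_
  rw [Finset.mul_sum]
  refine Finset.sum_congr rfl fun y' hy' => ?_
  rw [if_pos (Finset.mem_product.2 ⟨hy, hy'⟩)]

/-- **The finite-volume forms converge to the `ℓ²` form** along the finite `T ⊂ ℤ^d`:
`Σ_{y,y'∈T} B(y)(Q'G'Q'*)(y,y')B(y') → ⟨B, Q'G'Q'*B⟩_{ℤ^d}` for `B ∈ ℓ²(ℤ^d)` (dominated convergence on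
`ℤ^d × ℤ^d`). [folklore] -/
theorem tendsto_qGqForm (n : ℕ) {a : ℝ} (ha : 0 < a) {Bf : X d → ℝ} (hB : Summable fun x => Bf x ^ 2) :
    Tendsto (fun T : Finset (X d) => ∑ y ∈ T, Bf y * ∑ y' ∈ T, kerQGQ n a y y' * Bf y') atTop
      (𝓝 (∑' y, Bf y * KZd n a Bf y)) := by
  rw [inner_KZd_eq_tsum_prod n ha hB]
  simp_rw [qGqForm_eq_tsum_ite]
  refine tendsto_tsum_of_dominated_convergence
    (bound := fun xy : X d × X d => |Bf xy.1 * (kerQGQ n a xy.1 xy.2 * Bf xy.2)|)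
    (summable_qGq_pair n ha hB).abs (fun xy => ?_) (Eventually.of_forall fun T xy => ?_)
  · have hev : (fun T : Finset (X d) =>
        if xy ∈ T ×ˢ T then Bf xy.1 * (kerQGQ n a xy.1 xy.2 * Bf xy.2) else 0)
        =ᶠ[atTop] fun _ => Bf xy.1 * (kerQGQ n a xy.1 xy.2 * Bf xy.2) := by
      filter_upwards [eventually_ge_atTop ({xy.1, xy.2} : Finset (X d))] with T hT
      exact if_pos (Finset.mem_product.2 ⟨hT (by simp), hT (by simp)⟩)
    exact tendsto_const_nhds.congr' hev.symm
  · by_cases h : xy ∈ T ×ˢ T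
    · rw [if_pos h, Real.norm_eq_abs]
    · rw [if_neg h, norm_zero]; exact abs_nonneg _

/-- **(1.100), upper half, on `ℓ²(ℤ^d)`**: `⟨B, Q'G'Q'*B⟩_{ℤ^d} ≤ a⁻¹‖B‖²_{ℓ²}` for EVERY square-summable coarse
field, every `n`, every `a > 0` («QGQ* ≤ a⁻¹I»; from the column's finite-volume `qGq_upper_printed` by exhaustion).
[cite: Balaban1984PropagatorsI, (1.100) p.34] -/
theorem inner_KZd_le (n : ℕ) {a : ℝ} (ha : 0 < a) (Bf : X d → ℝ) (hB : Summable fun x => Bf x ^ 2) :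
    ∑' y, Bf y * KZd n a Bf y ≤ 1 / a * ∑' y, Bf y ^ 2 :=
  le_of_tendsto_of_tendsto' (tendsto_qGqForm n ha hB) ((tendsto_finset_sum hB).const_mul (1 / a))
    fun T => qGq_upper_printed n ha T Bf

/-- **(1.100), lower half, on `ℓ²(ℤ^d)`** with the column's sharp constant: `2γ₀‖B‖²_{ℓ²} ≤ ⟨B, Q'G'Q'*B⟩_{ℤ^d}`,
`2γ₀ = (4/π²)^d/(a(4/π²)^d + dπ²) = (a + 4d(π²/4)^{d+1})⁻¹`, for EVERY square-summable coarse field («bounded from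
below … by positive constants dependent on d only (for a = 1). The same property holds for QGQ*.»; from
`qGq_lower_printed` by exhaustion). [cite: Balaban1984PropagatorsI, (1.100) p.34] -/
theorem inner_KZd_ge (n : ℕ) {a : ℝ} (ha : 0 < a) (Bf : X d → ℝ) (hB : Summable fun x => Bf x ^ 2) :
    twoGamma0 d a * ∑' y, Bf y ^ 2 ≤ ∑' y, Bf y * KZd n a Bf y :=
  le_of_tendsto_of_tendsto' ((tendsto_finset_sum hB).const_mul (twoGamma0 d a)) (tendsto_qGqForm n ha hB)
    fun T => qGq_lower_printed n ha T Bf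

/-- The lower constant in the `γ₁♯` bookkeeping of the column: `2γ₀ = (a + 4dγ₁♯)⁻¹`, so
`(a + 4d(π²/4)^{d+1})⁻¹‖B‖² ≤ ⟨B, Q'G'Q'*B⟩_{ℤ^d}` on `ℓ²(ℤ^d)`. [cite: Balaban1984PropagatorsI, (1.100) p.34] -/
theorem inner_KZd_ge' (n : ℕ) {a : ℝ} (ha : 0 < a) (Bf : X d → ℝ) (hB : Summable fun x => Bf x ^ 2) :
    1 / (a + 4 * d * gamma1Sharp d) * ∑' y, Bf y ^ 2 ≤ ∑' y, Bf y * KZd n a Bf y := by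
  rw [← twoGamma0_eq_inv d a ha]
  exact inner_KZd_ge n ha Bf hB

/-- **(1.100) in the printed shape, on `ℓ²(ℤ^d)`**: there are constants `0 < c₋ ≤ c₊` depending on `d` and `a` only
(NOT on the mesh `n`) with `c₋‖B‖² ≤ ⟨B, Q'G'Q'*B⟩_{ℤ^d} ≤ c₊‖B‖²` for every `n` and every `B ∈ ℓ²(ℤ^d)` (witnesses
`c₋ = 2γ₀(d,a)`, `c₊ = a⁻¹`). [cite: Balaban1984PropagatorsI, (1.100) p.34] -/
theorem inner_KZd_bounds_exists (d : ℕ) {a : ℝ} (ha : 0 < a) :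
    ∃ cl cu : ℝ, 0 < cl ∧ cl ≤ cu ∧ ∀ (n : ℕ) (Bf : X d → ℝ), (Summable fun x => Bf x ^ 2) →
      cl * ∑' y, Bf y ^ 2 ≤ ∑' y, Bf y * KZd n a Bf y ∧ ∑' y, Bf y * KZd n a Bf y ≤ cu * ∑' y, Bf y ^ 2 := by
  classical
  refine ⟨twoGamma0 d a, 1 / a, twoGamma0_pos d ha, ?_, fun n Bf hB =>
    ⟨inner_KZd_ge n ha Bf hB, inner_KZd_le n ha Bf hB⟩⟩
  -- `2γ₀ ≤ a⁻¹`, read off from the two bounds at the field `δ_0 ∈ ℓ²(ℤ^d)` (mesh `n = 0`)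
  set δ0 : X d → ℝ := fun y => if y = 0 then 1 else 0 with hδ
  have hs : Summable fun y => δ0 y ^ 2 := summable_of_ne_finset_zero (s := {0}) fun y hy => by
    rw [Finset.mem_singleton] at hy; simp [hδ, hy]
  have hone : ∑' y, δ0 y ^ 2 = 1 := by
    rw [tsum_eq_single 0 fun y hy => by simp [hδ, hy]]; simp [hδ]
  have h1 := inner_KZd_ge 0 ha δ0 hs
  have h2 := inner_KZd_le 0 ha δ0 hs
  rw [hone, mul_one] at h1 h2
  exact h1.trans h2

/-! ## §3  `(Q'G'Q'*)⁻¹` on `ℓ²(ℤ^d)` [print-located: «−ω = (QGQ*)⁻¹B» (1.102); proved outright] -/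

/-- `((Q'G'Q'*)⁻¹B)(y) = Σ'_{y'} (Q'G'Q'*)⁻¹(y,y')B(y')` — the inverse of the averaged propagator (scalar, unit
lattice: the kernel `Kinv` of `B5Hk103ScalarZd`, [B4] (5.7)) applied to an ARBITRARY coarse field on `ℤ^d`
(absolutely convergent for `B ∈ ℓ²`, `summable_KinvZd_row`). [cite: Balaban1984PropagatorsI, (1.102) p.34] -/
def KinvZd (n : ℕ) (a : ℝ) (Bf : X d → ℝ) (y : X d) : ℝ := ∑' y' : X d, Kinv n a y y' * Bf y'

/-- `(Q'G'Q'*)⁻¹ = Δ^{scalar}_{n,a} + aI` entrywise (the definition of the coarse action kernel, (1.65)).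
[folklore] -/
theorem Kinv_eq_actionKer_add (n : ℕ) (a : ℝ) (y y' : X d) :
    Kinv n a y y' = actionKer n a y y' + a * (if y = y' then 1 else 0) := by
  unfold actionKer; ring

/-- The diagonal part `a·δ_{yy'}B(y')` of a row is (trivially) summable. [folklore] -/
theorem summable_diag_row (a : ℝ) (Bf : X d → ℝ) (y : X d) :
    Summable fun y' : X d => a * (if y = y' then 1 else 0) * Bf y' :=
  summable_of_ne_finset_zero (s := {y}) fun y' hy' => by
    rw [Finset.mem_singleton] at hy'
    rw [if_neg (fun h => hy' h.symm)]; ring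

/-- `Σ'_{y'} a·δ_{yy'}B(y') = a·B(y)`. [folklore] -/
theorem tsum_diag_row (a : ℝ) (Bf : X d → ℝ) (y : X d) :
    ∑' y' : X d, a * (if y = y' then 1 else 0) * Bf y' = a * Bf y := by
  rw [tsum_eq_single y fun y' hy' => by rw [if_neg (fun h => hy' h.symm)]; ring]
  simp

/-- Every row series `Σ'_{y'} (Q'G'Q'*)⁻¹(y,y')B(y')` converges absolutely (`B ∈ ℓ²`). [folklore] -/
theorem summable_KinvZd_row (n : ℕ) {a : ℝ} (ha : 0 < a) {Bf : X d → ℝ} (hB : Summable fun x => Bf x ^ 2)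
    (y : X d) : Summable fun y' : X d => Kinv n a y y' * Bf y' :=
  ((summable_deltaApply_row n ha hB y).add (summable_diag_row a Bf y)).congr fun y' => by
    rw [Kinv_eq_actionKer_add]; ring

/-- **`(Q'G'Q'*)⁻¹B = Δ^{scalar}_{n,a}B + aB`** on `ℓ²(ℤ^d)`, row by row. [cite: Balaban1984PropagatorsI, (1.65) p.29] -/
theorem KinvZd_eq (n : ℕ) {a : ℝ} (ha : 0 < a) {Bf : X d → ℝ} (hB : Summable fun x => Bf x ^ 2) (y : X d) :
    KinvZd n a Bf y = deltaApply n a Bf y + a * Bf y := by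
  unfold KinvZd deltaApply
  rw [← tsum_diag_row a Bf y, ← (summable_deltaApply_row n ha hB y).tsum_add (summable_diag_row a Bf y)]
  exact tsum_congr fun y' => by rw [Kinv_eq_actionKer_add]; ring

/-- `(Q'G'Q'*)⁻¹B ∈ ℓ²(ℤ^d)` for `B ∈ ℓ²(ℤ^d)`. [folklore] -/
theorem summable_KinvZd_sq (n : ℕ) {a : ℝ} (ha : 0 < a) {Bf : X d → ℝ} (hB : Summable fun x => Bf x ^ 2) :
    Summable fun y => KinvZd n a Bf y ^ 2 := by
  have h1 := (deltaApply_l2 n ha hB).1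
  have h2 : Summable fun y => (a * Bf y) ^ 2 := by simpa only [mul_pow] using hB.mul_left (a ^ 2)
  refine Summable.of_nonneg_of_le (fun y => sq_nonneg _) (fun y => ?_) ((h1.add h2).mul_left 2)
  rw [KinvZd_eq n ha hB]
  nlinarith [sq_nonneg (deltaApply n a Bf y - a * Bf y)]

/-- **The form of the inverse**: `⟨B, (Q'G'Q'*)⁻¹B⟩_{ℤ^d} = ⟨B, Δ^{scalar}_{n,a}B⟩_{ℤ^d} + a‖B‖²_{ℓ²}` on `ℓ²(ℤ^d)`.
[cite: Balaban1984PropagatorsI, (1.65) p.29] -/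
theorem inner_KinvZd_eq (n : ℕ) {a : ℝ} (ha : 0 < a) {Bf : X d → ℝ} (hB : Summable fun x => Bf x ^ 2) :
    ∑' y, Bf y * KinvZd n a Bf y = actionFormZd n a Bf + a * ∑' y, Bf y ^ 2 := by
  have h1 : Summable fun y => Bf y * deltaApply n a Bf y := summable_mul_of_sq hB (deltaApply_l2 n ha hB).1
  have h2 : Summable fun y => a * Bf y ^ 2 := hB.mul_left a
  rw [actionFormZd_eq_inner n ha hB, ← tsum_mul_left, ← h1.tsum_add h2]
  exact tsum_congr fun y => by rw [KinvZd_eq n ha hB]; ring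

/-- **Coercivity of the inverse on `ℓ²(ℤ^d)`**: `a‖B‖²_{ℓ²} ≤ ⟨B, (Q'G'Q'*)⁻¹B⟩_{ℤ^d}` (positivity of the action form,
(1.67)); dual to «QGQ* ≤ a⁻¹I». [cite: Balaban1984PropagatorsI, (1.100) p.34] -/
theorem inner_KinvZd_ge (n : ℕ) {a : ℝ} (ha : 0 < a) (Bf : X d → ℝ) (hB : Summable fun x => Bf x ^ 2) :
    a * ∑' y, Bf y ^ 2 ≤ ∑' y, Bf y * KinvZd n a Bf y := by
  rw [inner_KinvZd_eq n ha hB]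
  linarith [actionFormZd_nonneg n ha Bf hB]

/-- **Boundedness of the inverse form on `ℓ²(ℤ^d)`, uniformly in the mesh**:
`⟨B, (Q'G'Q'*)⁻¹B⟩_{ℤ^d} ≤ (a + 4d(π²/4)^{d+1})‖B‖²_{ℓ²} = (2γ₀)⁻¹‖B‖²` (the upper half of (1.67) on `ℓ²` and
`⟨∂₁B, ∂₁B⟩ ≤ 4d‖B‖²`); dual to the lower half of (1.100). [cite: Balaban1984PropagatorsI, (1.100) p.34] -/
theorem inner_KinvZd_le (n : ℕ) {a : ℝ} (ha : 0 < a) (Bf : X d → ℝ) (hB : Summable fun x => Bf x ^ 2) :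
    ∑' y, Bf y * KinvZd n a Bf y ≤ (a + 4 * d * gamma1Sharp d) * ∑' y, Bf y ^ 2 := by
  rw [inner_KinvZd_eq n ha hB]
  have h1 := ineq167_upper_l2 n ha Bf hB
  have h2 := mul_le_mul_of_nonneg_left (energy_le_four_d hB (d := d)) (gamma1Sharp_pos d).le
  linarith

/-! ## §4  (1.102): `Q'G'Q'*` and `(Q'G'Q'*)⁻¹` are mutually inverse on `ℓ²(ℤ^d)` [print-located; proved outright] -/

/-- `(Q'G'Q'*)(Q'G'Q'*)⁻¹ = I` entrywise, series over the middle index (from the column's `(Q'G'Q'*)⁻¹(Q'G'Q'*) = I`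
and the symmetry of both kernels). [folklore] -/
theorem tsum_kerQGQ_mul_Kinv (n : ℕ) {a : ℝ} (ha : 0 < a) (z y' : X d) :
    ∑' y : X d, kerQGQ n a z y * Kinv n a y y' = if z = y' then 1 else 0 := by
  have h := tsum_Kinv_mul_kerQGQ n ha y' z
  rw [show (fun y : X d => kerQGQ n a z y * Kinv n a y y') = fun y : X d => Kinv n a y' y * kerQGQ n a y z from
    funext fun y => by rw [kerQGQ_symm n ha z y, Kinv_symm n ha y y', mul_comm], h]
  by_cases hz : z = y'
  · rw [if_pos hz, if_pos hz.symm]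
  · rw [if_neg hz, if_neg (fun h' => hz h'.symm)]

/-- **`(Q'G'Q'*)⁻¹(Q'G'Q'* B) = B` for every `B ∈ ℓ²(ℤ^d)`** (Fubini under the majorant
`c_inv c_Q ‖B‖_{ℓ²} e^{−δ_inv|y−y'|}e^{−δ_Q|y'−z|}`). [cite: Balaban1984PropagatorsI, (1.102) p.34] -/
theorem KinvZd_KZd (n : ℕ) {a : ℝ} (ha : 0 < a) {Bf : X d → ℝ} (hB : Summable fun x => Bf x ^ 2) (y : X d) :
    KinvZd n a (KZd n a Bf) y = Bf y := by
  set N : ℝ := Real.sqrt (∑' y, Bf y ^ 2) with hN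
  have hswap := tsum_mul_tsum_comm (f := fun y' => Kinv n a y y') (g := fun y' z => kerQGQ n a y' z * Bf z)
    (C := cInv d a * cQ d n a * N) (deltaInv_pos d ha) (deltaQ_pos n ha) y (fun y' z => by
      rw [abs_mul, abs_mul]
      have h1 := abs_Kinv_le n ha y y'
      have h2 := abs_kerQGQ_le n ha y' z
      have h3 := abs_le_sqrt_tsum_sq hB z
      have e1 := (Real.exp_pos (-(deltaInv d a * dist y y'))).le
      have e2 := (Real.exp_pos (-(deltaQ d n a * dist y' z))).le
      calc |Kinv n a y y'| * (|kerQGQ n a y' z| * |Bf z|)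
          ≤ (cInv d a * Real.exp (-(deltaInv d a * dist y y')))
              * ((cQ d n a * Real.exp (-(deltaQ d n a * dist y' z))) * N) :=
            mul_le_mul h1 (mul_le_mul h2 h3 (abs_nonneg _) (mul_nonneg (cQ_pos n ha).le (Real.exp_pos _).le))
              (mul_nonneg (abs_nonneg _) (abs_nonneg _)) (mul_nonneg (cInv_pos d ha).le (Real.exp_pos _).le)
        _ = cInv d a * cQ d n a * N * Real.exp (-(deltaInv d a * dist y y'))
              * Real.exp (-(deltaQ d n a * dist y' z)) := by ring)
  show ∑' y', Kinv n a y y' * KZd n a Bf y' = Bf y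
  simp only [KZd]
  rw [hswap]
  have hinner : ∀ z : X d, ∑' y' : X d, Kinv n a y y' * (kerQGQ n a y' z * Bf z) = (if y = z then 1 else 0) * Bf z :=
    fun z => by
      rw [← tsum_Kinv_mul_kerQGQ n ha y z, ← tsum_mul_right]
      exact tsum_congr fun y' => by ring
  rw [tsum_congr hinner, tsum_eq_single y fun z hz => by rw [if_neg (fun h => hz h.symm), zero_mul]]
  simp

/-- **`Q'G'Q'*((Q'G'Q'*)⁻¹B) = B` for every `B ∈ ℓ²(ℤ^d)`**. [cite: Balaban1984PropagatorsI, (1.102) p.34] -/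
theorem KZd_KinvZd (n : ℕ) {a : ℝ} (ha : 0 < a) {Bf : X d → ℝ} (hB : Summable fun x => Bf x ^ 2) (z : X d) :
    KZd n a (KinvZd n a Bf) z = Bf z := by
  set N : ℝ := Real.sqrt (∑' y, Bf y ^ 2) with hN
  have hswap := tsum_mul_tsum_comm (f := fun y => kerQGQ n a z y) (g := fun y y' => Kinv n a y y' * Bf y')
    (C := cQ d n a * cInv d a * N) (deltaQ_pos n ha) (deltaInv_pos d ha) z (fun y y' => by
      rw [abs_mul, abs_mul]
      have h1 := abs_kerQGQ_le n ha z y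
      have h2 := abs_Kinv_le n ha y y'
      have h3 := abs_le_sqrt_tsum_sq hB y'
      calc |kerQGQ n a z y| * (|Kinv n a y y'| * |Bf y'|)
          ≤ (cQ d n a * Real.exp (-(deltaQ d n a * dist z y)))
              * ((cInv d a * Real.exp (-(deltaInv d a * dist y y'))) * N) :=
            mul_le_mul h1 (mul_le_mul h2 h3 (abs_nonneg _) (mul_nonneg (cInv_pos d ha).le (Real.exp_pos _).le))
              (mul_nonneg (abs_nonneg _) (abs_nonneg _)) (mul_nonneg (cQ_pos n ha).le (Real.exp_pos _).le)
        _ = cQ d n a * cInv d a * N * Real.exp (-(deltaQ d n a * dist z y))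
              * Real.exp (-(deltaInv d a * dist y y')) := by ring)
  show ∑' y, kerQGQ n a z y * KinvZd n a Bf y = Bf z
  simp only [KinvZd]
  rw [hswap]
  have hinner : ∀ y' : X d, ∑' y : X d, kerQGQ n a z y * (Kinv n a y y' * Bf y') = (if z = y' then 1 else 0) * Bf y' :=
    fun y' => by
      rw [← tsum_kerQGQ_mul_Kinv n ha z y', ← tsum_mul_right]
      exact tsum_congr fun y => by ring
  rw [tsum_congr hinner, tsum_eq_single z fun y' hy' => by rw [if_neg (fun h => hy' h.symm), zero_mul]]
  simp

/-- **(1.102) on `ℓ²(ℤ^d)`, existence**: for `B ∈ ℓ²(ℤ^d)` the field `ω = −(Q'G'Q'*)⁻¹B` is square-summable and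
solves `−Q'G'Q'*ω = B`. [cite: Balaban1984PropagatorsI, (1.102) p.34] -/
theorem eq1102_exists (n : ℕ) {a : ℝ} (ha : 0 < a) {Bf : X d → ℝ} (hB : Summable fun x => Bf x ^ 2) :
    (Summable fun y => (-KinvZd n a Bf y) ^ 2) ∧ ∀ z, -KZd n a (fun y => -KinvZd n a Bf y) z = Bf z := by
  refine ⟨by simpa only [neg_sq] using summable_KinvZd_sq n ha hB, fun z => ?_⟩
  have hlin : KZd n a (fun y => -KinvZd n a Bf y) z = -KZd n a (KinvZd n a Bf) z := by
    simp only [KZd, mul_neg, tsum_neg]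
  rw [hlin, neg_neg, KZd_KinvZd n ha hB]

/-- **(1.102) on `ℓ²(ℤ^d)`, uniqueness**: a square-summable `ω` with `−Q'G'Q'*ω = B` IS `−(Q'G'Q'*)⁻¹B`
(«−QGQ*ω = B, −ω = (QGQ*)⁻¹B»). [cite: Balaban1984PropagatorsI, (1.102) p.34] -/
theorem eq1102_unique (n : ℕ) {a : ℝ} (ha : 0 < a) {Bf ω : X d → ℝ} (hω : Summable fun x => ω x ^ 2)
    (h : ∀ z, -KZd n a ω z = Bf z) (y : X d) : -ω y = KinvZd n a Bf y := by
  have hB : Bf = fun z => -KZd n a ω z := funext fun z => (h z).symm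
  rw [hB]
  have hlin : KinvZd n a (fun z => -KZd n a ω z) y = -KinvZd n a (KZd n a ω) y := by
    simp only [KinvZd, mul_neg, tsum_neg]
  rw [hlin, KinvZd_KZd n ha hω]

/-- **`(Q'G'Q'*)⁻¹` has the two-sided form bounds dual to (1.100) on `ℓ²(ℤ^d)`, uniformly in the mesh**:
`a‖B‖² ≤ ⟨B, (Q'G'Q'*)⁻¹B⟩_{ℤ^d} ≤ (2γ₀)⁻¹‖B‖²` with `(2γ₀)⁻¹ = a + 4d(π²/4)^{d+1}`, every `n`, every `a > 0`,
every `B ∈ ℓ²(ℤ^d)`. [cite: Balaban1984PropagatorsI, (1.100) p.34] -/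
theorem inner_KinvZd_bounds (n : ℕ) {a : ℝ} (ha : 0 < a) (Bf : X d → ℝ) (hB : Summable fun x => Bf x ^ 2) :
    a * ∑' y, Bf y ^ 2 ≤ ∑' y, Bf y * KinvZd n a Bf y ∧
      ∑' y, Bf y * KinvZd n a Bf y ≤ (twoGamma0 d a)⁻¹ * ∑' y, Bf y ^ 2 := by
  refine ⟨inner_KinvZd_ge n ha Bf hB, ?_⟩
  rw [twoGamma0_eq_inv d a ha, one_div, inv_inv]
  exact inner_KinvZd_le n ha Bf hB

/-! ## §5  (1.103): `H_k = G'Q'*(Q'G'Q'*)⁻¹` as a composition of operators on `ℓ²(ℤ^d)` [print-located; proved outright] -/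

/-- **(1.103) on `ℓ²(ℤ^d)`**: for every square-summable coarse field `B` and every fine site `p`,
`(H B)(p) = Σ'_{y'} (G'Q'*)(p,y')·((Q'G'Q'*)⁻¹B)(y')`, i.e. `H_kB = GQ*(QGQ*)⁻¹B` with `(QGQ*)⁻¹B ∈ ℓ²(ℤ^d)` the
field of §3 (Fubini under the majorant `c_u(n+1)^{d/2}c_inv‖B‖ e^{−δ_u|blk p−y'|}e^{−δ_inv|y'−y|}`).
[cite: Balaban1984PropagatorsI, (1.103) p.34] -/
theorem HBZd_eq_gq_KinvZd (n : ℕ) {a : ℝ} (ha : 0 < a) {Bf : X d → ℝ} (hB : Summable fun x => Bf x ^ 2) (p : X d) :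
    HBZd n a Bf p = ∑' y' : X d, gq n a p y' * KinvZd n a Bf y' := by
  set N : ℝ := Real.sqrt (∑' y, Bf y ^ 2) with hN
  set c : ℝ := cU d a * Real.sqrt (((n : ℝ) + 1) ^ d) with hc
  have hswap := tsum_mul_tsum_comm (f := fun y' => gq n a p y') (g := fun y' y => Kinv n a y' y * Bf y)
    (C := c * cInv d a * N) (deltaU_pos d ha) (deltaInv_pos d ha) (blk n p) (fun y' y => by
      rw [abs_mul, abs_mul]
      have h1 := abs_gq_le n ha p y'
      have h2 := abs_Kinv_le n ha y' y
      have h3 := abs_le_sqrt_tsum_sq hB y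
      calc |gq n a p y'| * (|Kinv n a y' y| * |Bf y|)
          ≤ (c * Real.exp (-(deltaU d a * dist (blk n p) y')))
              * ((cInv d a * Real.exp (-(deltaInv d a * dist y' y))) * N) :=
            mul_le_mul h1 (mul_le_mul h2 h3 (abs_nonneg _) (mul_nonneg (cInv_pos d ha).le (Real.exp_pos _).le))
              (mul_nonneg (abs_nonneg _) (abs_nonneg _))
              (mul_nonneg (mul_nonneg (cU_pos d ha).le (Real.sqrt_nonneg _)) (Real.exp_pos _).le)
        _ = c * cInv d a * N * Real.exp (-(deltaU d a * dist (blk n p) y'))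
              * Real.exp (-(deltaInv d a * dist y' y)) := by ring)
  simp only [KinvZd]
  rw [hswap]
  show ∑' y, Bf y * kerH n a p y = _
  refine tsum_congr fun y => ?_
  rw [kerH, ← tsum_mul_left]
  exact tsum_congr fun y' => by ring

/-- **The `ℓ²` operator identities of p.34 in one statement**: for `B ∈ ℓ²(ℤ^d)`, `(Q'G'Q'*)⁻¹B ∈ ℓ²(ℤ^d)`,
`Q'G'Q'*(Q'G'Q'*)⁻¹B = B = (Q'G'Q'*)⁻¹Q'G'Q'*B`, and `H B = G'Q'*((Q'G'Q'*)⁻¹B)`.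
[cite: Balaban1984PropagatorsI, (1.102)–(1.103) p.34] -/
theorem l2_operator_identities (n : ℕ) {a : ℝ} (ha : 0 < a) {Bf : X d → ℝ} (hB : Summable fun x => Bf x ^ 2) :
    (Summable fun y => KinvZd n a Bf y ^ 2) ∧ (Summable fun z => KZd n a Bf z ^ 2) ∧
      (∀ z, KZd n a (KinvZd n a Bf) z = Bf z) ∧ (∀ y, KinvZd n a (KZd n a Bf) y = Bf y) ∧
      ∀ p, HBZd n a Bf p = ∑' y' : X d, gq n a p y' * KinvZd n a Bf y' :=
  ⟨summable_KinvZd_sq n ha hB, summable_KZd_sq n ha hB, KZd_KinvZd n ha hB, KinvZd_KZd n ha hB,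
    HBZd_eq_gq_KinvZd n ha hB⟩

end

end Literature.MathematicalPhysics.QuantumFieldTheory.Balaban1983to89.B5QGQInverseL2Zd
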